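import Summits.BirchSwinnertonDyer.BirchSwinnertonDyer.Theses.PlecticLegs
import Literature.NumberTheory.EllipticCurves.KuriharaNumber
import Literature.NumberTheory.EllipticCurves.GaloisAction
import Literature.NumberTheory.EllipticCurves.Tamagawa
import Literature.NumberTheory.EllipticCurves.KatoKolyvaginPrimes
import Literature.NumberTheory.EllipticCurves.ModularCurvePeriodRatio
import Literature.NumberTheory.EllipticCurves.KuriharaNumberKimModP
import Literature.NumberTheory.EllipticCurves.NonvanishingTwistsHoffsteinLuo
import Literature.NumberTheory.EllipticCurves.PAdicBSD
import Literature.NumberTheory.EllipticCurves.GlobalMinimalModel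
import Summits.BirchSwinnertonDyer.BirchSwinnertonDyer.Theorems.PlecticLegsTwistSupplyStubCycloGlue
import Summits.BirchSwinnertonDyer.BirchSwinnertonDyer.Theorems.PlecticLegsTwistSupplyStubBaseVanishing
import Summits.BirchSwinnertonDyer.BirchSwinnertonDyer.Theorems.PlecticLegsTwistSupplyStubHeckeDescent
import Summits.BirchSwinnertonDyer.BirchSwinnertonDyer.Theorems.PlecticLegsTwistSupplyStubBirch
import Summits.BirchSwinnertonDyer.BirchSwinnertonDyer.Theorems.PlecticLegsTwistSupplyStubConjugacy
import Summits.BirchSwinnertonDyer.BirchSwinnertonDyer.Theorems.PlecticLegsTwistSupplyStubKuriharaSupply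
import Summits.BirchSwinnertonDyer.BirchSwinnertonDyer.Theorems.PlecticLegsTwistSupplyStubPrimeRankCase
import Summits.BirchSwinnertonDyer.BirchSwinnertonDyer.Theorems.PlecticLegsTwistSupplyStubRankTwo
import Summits.BirchSwinnertonDyer.BirchSwinnertonDyer.Theorems.PlecticLegsTwistSupplyStubPrimeRankKurihara
import Summits.BirchSwinnertonDyer.BirchSwinnertonDyer.Theorems.PlecticLegsTwistSupplyStubRankThreeSupply
import HarnessLib

/-!
# Line `Sketch` = `kurihara-fourier-support` for the crux `PlecticLegs.TwistSupply`
# (stmt-BirchSwinnertonDyer-18260) — skeleton, revision 5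

Crux (fixed, route `route-BirchSwinnertonDyer-PlecticLegs`, rank 4): for every elliptic `E/ℚ`
with `r = r_an(E) ≥ 2` there are `m` and `H ≤ Gal(ℚ(ζ_m)/ℚ)` with fixed field `F` totally real of
degree `r` such that every non-trivial Dirichlet character `χ mod m` trivial on `H` has
`L(E, χ, 1) ≠ 0` (entire continuation of `∑ χ(n) aₙ(E) n⁻ˢ` non-zero at `s = 1`).

The line (crux ideas `kurihara-fourier-support` / `kurihara-fourier-forcing`; payload line slugs
`Sketch`, `KuriharaFourierSupportFirstLemma`). Registered stubs of this revision:

1. `stub_printedFacts` — BLOCKED by design: the conjunction of FOUR named Literature facts, none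
   discharged in the tree: modularity `exists_isNewformOf` (BCDT 2001); Kurihara's conjecture in
   Kim's class `Kim2022_exists_kuriharaNumber_modP_ne_zero` (C.-H. Kim 2022 Thm. 1.11 (3)⇒(1); filed
   by this line, p161611); the period transfer `realPeriodRat_eq_unit_mul_plusPeriod`
   (Greenberg–Vatsal 2000); Hoffstein–Luo 1997 `HoffsteinLuo1997_exists_twist_L_one_ne_zero`.
2. `stub_primeRankCase` — LANDED (p165087, `Theorems/PlecticLegsTwistSupplyStubPrimeRankCase.lean`): the crux for PRIME analytic rank `ℓ ≥ 5` in Kim's class (good ordinary, `ρ̄` onto,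
   `E(ℚ_ℓ)[ℓ] = 0`, `ℓ ∤ ∏ c_v`), modulo the first three facts, by the chain of SIX LANDED helper
   stubs: `stub_kuriharaSupply` (p162776) → `stub_baseVanishing` (p159458) → `stub_heckeDescent`
   (p160306, `d = 1`) → first lemma (finite Fourier analysis) → `stub_heckeDescent` (conductor) →
   `stub_birch` (p160795) + `stub_conjugacy` (p161259) → `stub_cycloGlue` (p159199).
3. `stub_rankTwo` — LANDED (p165125, `Theorems/PlecticLegsTwistSupplyStubRankTwo.lean`):
   `r_an = 2` (Hoffstein–Luo + root-number parity + Kronecker dictionary), modulo modularity and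
   Hoffstein–Luo.
3b. `stub_primeRankKurihara` (rev 4) — the prime-rank chain from a KURIHARA CERTIFICATE (`f` with
   `aₙ(f) = aₙ(W)`, square-free `n ⊥ N`, `ℓ`-integral symbols, `δ_n ≢ 0 mod ℓ`), UNCONDITIONAL; the
   composition feeds it either a certificate found directly or the one `stub_kuriharaSupply` extracts
   from the printed facts in Kim's class (`stub_primeRankCase` = that composite, kept in the tree).
4. `stub_residual` — OPEN (crux-sized; the honest debt): `r_an ≥ 3`, NO Kurihara certificate at a
   prime `ℓ = r_an`, and NO prime `ℓ = r_an` in Kim's class — composite analytic rank (`4, 6, 8, 9, …`) or prime analytic rank outside Kim's class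
   (`r_an = 3`, e.g. `5077a1`; bad / supersingular / anomalous `ℓ`; `ρ̄` not onto; `ℓ ∣ Tam`).

`TwistSupply_of` (no `sorry` outside `stub_*`) assembles the stubs into the crux BY NAME.
-/

set_option linter.dupNamespace false

noncomputable section

open scoped Classical MatrixGroups ModularForm

open CongruenceSubgroup

namespace Summit.BirchSwinnertonDyer.BirchSwinnertonDyer.Cruxes.TwistSupply.KuriharaFourierSupport

open WeierstrassCurve Literature.NumberTheory.EllipticCurves
  Literature.NumberTheory.EllipticCurves.ModularForms

/-! ### Stubs -/

/-- **Printed facts** (BLOCKED stub = four named facts of the Literature, none discharged in the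
tree): (a) modularity `exists_isNewformOf` (Breuil–Conrad–Diamond–Taylor 2001, Thm. A); (b) Kim 2022,
Thm. 1.11 (3)⇒(1), clause-free: `Kim2022_exists_kuriharaNumber_modP_ne_zero` (filed by this line,
p161611); (c) the period transfer `realPeriodRat_eq_unit_mul_plusPeriod` (Greenberg–Vatsal 2000
Rem. 3.4 + Abbes–Ullmo 1996 + Edixhoven 1991); (d) Hoffstein–Luo 1997
`HoffsteinLuo1997_exists_twist_L_one_ne_zero`. Size XL each; this stub only NAMES the printed input. -/
theorem stub_printedFacts :
    exists_isNewformOf ∧ Kim2022_exists_kuriharaNumber_modP_ne_zero ∧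
      realPeriodRat_eq_unit_mul_plusPeriod ∧ HoffsteinLuo1997_exists_twist_L_one_ne_zero ∧
    -- (e) Sakamoto 2022 Thm 1.2 = Cor 4.3 (IMC ⟹ Kurihara, p ≥ 3 incl. 3), stated inline
    (∀ (W : WeierstrassCurve ℚ) [W.IsElliptic] [W.IsGloballyMinimal] (p : ℕ) [Fact p.Prime],
      3 ≤ p → W.HasGoodReductionAtPrime p → ¬ (p : ℤ) ∣ W.frobeniusTrace p →
      W.HasSurjectiveModNGaloisRep p →
      ¬ p ∣ reductionPointCount W p → ¬ p ∣ W.tamagawaProduct →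
      ∀ {N : ℕ} [NeZero N] (f : CuspForm (Gamma0 N) 2), IsNewformOf W f →
      ∀ u : ℚ, ‖(u : ℚ_[p])‖ = 1 → W.realPeriodRat = u * plusPeriod f →
      (∀ (κ : ZpExtension ℚ p) (γ : Field.absoluteGaloisGroup ℚ), κ.IsCyclotomic →
        κ.IsTopGenerator γ → IsCyclotomicVariable p γ → ∀ S : W.SelmerDualData κ γ,
        S.IsTorsion ∧ ∃ g : IwasawaAlgebra p, S.charIdeal = Ideal.span {g} ∧
          iwasawaToPowerSeries p g =
            PowerSeries.C ((u : ℚ_[p])⁻¹) * padicLFunction f (unitRoot W p : ℚ_[p])) →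
      ∃ (n : ℕ) (_ : NeZero n), Kato.IsKolyvaginProduct W p 1 n ∧
        ∃ ψ : (ℓ : ℕ) → (ZMod ℓ)ˣ →* Multiplicative (ZMod p),
          (∀ ℓ ∈ n.primeFactors, Function.Surjective (ψ ℓ)) ∧ kuriharaNumber f p n ψ ≠ 0) ∧
    -- (f) period transfer at 3 (Greenberg–Vatsal + Mazur 1978 Cor 4.1 + Edixhoven), inline (= p166484)
    (∀ (W : WeierstrassCurve ℚ) [W.IsElliptic] [W.IsGloballyMinimal],
      W.HasGoodReductionAtPrime 3 → W.HasIrreducibleModPGaloisRep 3 →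
      ∀ {N : ℕ} [NeZero N] (f : CuspForm (Gamma0 N) 2), IsNewformOf W f →
      ∃ u : ℚ, ‖(u : ℚ_[3])‖ = 1 ∧ W.realPeriodRat = u * plusPeriod f) ∧
    -- (g) Skinner–Urban 2014 Thm 3.6.9 (tree fact `skinner_urban_main_conjecture`, universal closure)
    (∀ (W : WeierstrassCurve ℚ) [W.IsElliptic] [W.IsGloballyMinimal] (p : ℕ) [Fact p.Prime]
      (κ : ZpExtension ℚ p) (γ : Field.absoluteGaloisGroup ℚ) (N : ℕ) [NeZero N]
      (f : CuspForm (Gamma0 N) 2), @skinner_urban_main_conjecture W _ p _ κ γ N _ f) := by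
  sorry

/-- **Analytic rank three — the Sakamoto–Skinner–Urban certificate supplier** (LANDED p167215;
modulo the printed facts (a), (e), (f), (g) taken as hypotheses): for an elliptic `W/ℚ` with good
ORDINARY reduction at `3`, `ρ̄_{W,3^m}` onto for every `m` (so `ρ_{W,3}` onto `GL₂(ℤ₃)`; at `3`
surjectivity mod `3` does not lift), `3 ∤ #Ẽ(𝔽₃) = 4 − a₃` (i.e. `a₃ ∈ {−1, 2}`), `3 ∤ ∏ c_v`, and an
auxiliary prime `q ∥ N` of multiplicative reduction with `3 ∤ v_q(Δ_min)` (`ρ̄_{W,3}` ramified at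
`q`; Skinner–Urban's hypothesis), a Kurihara certificate at `3` exists: minimal model `C • W`,
newform at level `N_E` (modularity), `u` (period transfer at `3`, `E[3]` irreducible), the
main-conjecture identity at `3` from Skinner–Urban's integral clause (rescaled by
`exists_span_eq_and_map_eq_C_inv_mul_iff`), then Sakamoto; coprimality from `IsKolyvaginProduct`,
`3`-integrality of the symbols from irreducibility. Size L. -/
theorem stub_rankThreeSupply :
    exists_isNewformOf →
    (∀ (W : WeierstrassCurve ℚ) [W.IsElliptic] [W.IsGloballyMinimal] (p : ℕ) [Fact p.Prime],
      3 ≤ p → W.HasGoodReductionAtPrime p → ¬ (p : ℤ) ∣ W.frobeniusTrace p →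
      W.HasSurjectiveModNGaloisRep p →
      ¬ p ∣ reductionPointCount W p → ¬ p ∣ W.tamagawaProduct →
      ∀ {N : ℕ} [NeZero N] (f : CuspForm (Gamma0 N) 2), IsNewformOf W f →
      ∀ u : ℚ, ‖(u : ℚ_[p])‖ = 1 → W.realPeriodRat = u * plusPeriod f →
      (∀ (κ : ZpExtension ℚ p) (γ : Field.absoluteGaloisGroup ℚ), κ.IsCyclotomic →
        κ.IsTopGenerator γ → IsCyclotomicVariable p γ → ∀ S : W.SelmerDualData κ γ,
        S.IsTorsion ∧ ∃ g : IwasawaAlgebra p, S.charIdeal = Ideal.span {g} ∧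
          iwasawaToPowerSeries p g =
            PowerSeries.C ((u : ℚ_[p])⁻¹) * padicLFunction f (unitRoot W p : ℚ_[p])) →
      ∃ (n : ℕ) (_ : NeZero n), Kato.IsKolyvaginProduct W p 1 n ∧
        ∃ ψ : (ℓ : ℕ) → (ZMod ℓ)ˣ →* Multiplicative (ZMod p),
          (∀ ℓ ∈ n.primeFactors, Function.Surjective (ψ ℓ)) ∧ kuriharaNumber f p n ψ ≠ 0) →
    (∀ (W : WeierstrassCurve ℚ) [W.IsElliptic] [W.IsGloballyMinimal],
      W.HasGoodReductionAtPrime 3 → W.HasIrreducibleModPGaloisRep 3 →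
      ∀ {N : ℕ} [NeZero N] (f : CuspForm (Gamma0 N) 2), IsNewformOf W f →
      ∃ u : ℚ, ‖(u : ℚ_[3])‖ = 1 ∧ W.realPeriodRat = u * plusPeriod f) →
    (∀ (W : WeierstrassCurve ℚ) [W.IsElliptic] [W.IsGloballyMinimal] (p : ℕ) [Fact p.Prime]
      (κ : ZpExtension ℚ p) (γ : Field.absoluteGaloisGroup ℚ) (N : ℕ) [NeZero N]
      (f : CuspForm (Gamma0 N) 2), @skinner_urban_main_conjecture W _ p _ κ γ N _ f) →
    ∀ (W : WeierstrassCurve ℚ) [W.IsElliptic],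
      W.HasGoodReductionAtPrime 3 → ¬ (3 : ℤ) ∣ W.LFunction 3 →
      (∀ m : ℕ, W.HasSurjectiveModNGaloisRep ((3 ^ m : ℕ) : ℤ)) →
      ¬ (3 : ℤ) ∣ 4 - W.LFunction 3 → ¬ 3 ∣ W.tamagawaProduct →
      (∃ (q : ℕ) (_ : Fact q.Prime), q ≠ 3 ∧ W.HasMultiplicativeReductionAtPrime q ∧
        ∃ (C : VariableChange ℚ) (_ : (C • W).IsGloballyMinimal),
          ¬ 3 ∣ padicValInt q (C • W).minimalDiscriminantInt) →
      ∃ (N : ℕ) (_ : NeZero N) (f : CuspForm (Gamma0 N) 2), IsNewformOf W f ∧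
        ∃ (n : ℕ) (_ : NeZero n), Squarefree n ∧ n.Coprime N ∧
          (∀ a : (ZMod n)ˣ, ¬ 3 ∣ (ratPlusSymbol f (((a : ZMod n).val : ℚ) / n)).den) ∧
          ∃ ψ : (q : ℕ) → (ZMod q)ˣ →* Multiplicative (ZMod 3), kuriharaNumber f 3 n ψ ≠ 0 :=
  Summit.BirchSwinnertonDyer.BirchSwinnertonDyer.Theorems.stub_rankThreeSupply

/-- **The prime-rank case from a Kurihara certificate** (UNCONDITIONAL; LANDED p165804,
`Theorems.stub_primeRankKurihara`): if `r_an(W) = ℓ` is prime and `W` carries a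
Kurihara certificate at `ℓ` — a cusp form `f ∈ S₂(Γ₀(N))` with `aₙ(f) = aₙ(W)`, a square-free `n`
prime to `N` with `ℓ`-integral symbols `[a/n]⁺_f`, and a non-zero mod-`ℓ` Kurihara number — then
the conclusion of the crux holds for `W`. No named fact: modularity enters as the datum `f`,
Kurihara's conjecture as the datum `(n, ψ)`; Kim's class (`stub_kuriharaSupply`, p162776),
Sakamoto's class at `ℓ = 3`, or an exact computation for one curve supply the certificate. -/
theorem stub_primeRankKurihara :
    ∀ (W : WeierstrassCurve ℚ) [W.IsElliptic] (ℓ : ℕ) [Fact ℓ.Prime], W.analyticRank = ℓ →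
      ∀ (N : ℕ) [NeZero N] (f : CuspForm (Gamma0 N) 2), IsNewformOf W f →
      ∀ (n : ℕ) [NeZero n], Squarefree n → n.Coprime N →
      (∀ a : (ZMod n)ˣ, ¬ ℓ ∣ (ratPlusSymbol f (((a : ZMod n).val : ℚ) / n)).den) →
      ∀ ψ : (q : ℕ) → (ZMod q)ˣ →* Multiplicative (ZMod ℓ), kuriharaNumber f ℓ n ψ ≠ 0 →
      ∃ (m : ℕ) (_ : NeZero m),
        ∃ H : Subgroup (CyclotomicField m ℚ ≃ₐ[ℚ] CyclotomicField m ℚ),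
          NumberField.IsTotallyReal ↥(IntermediateField.fixedField H) ∧
          Module.finrank ℚ ↥(IntermediateField.fixedField H) = W.analyticRank ∧
          ∀ χ : DirichletCharacter ℂ m,
            (∀ σ ∈ H, ∀ a : ℕ, (∀ z : CyclotomicField m ℚ, z ^ m = 1 → σ z = z ^ a) →
              χ (a : ZMod m) = 1) → χ ≠ 1 →
            ∃ L : ℂ → ℂ, Differentiable ℂ L ∧
              (∀ s : ℂ, 2 < s.re → L s = LSeries (fun n ↦ χ n * ((W.LFunction n : ℤ) : ℂ)) s) ∧
              L 1 ≠ 0 :=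
  Summit.BirchSwinnertonDyer.BirchSwinnertonDyer.Theorems.stub_primeRankKurihara

/-- **Analytic rank two** (LANDED p165125: `Theorems.stub_rankTwo`):
assuming modularity and Hoffstein–Luo 1997, every elliptic `W/ℚ` with `r_an(W) = 2` has a silent
real quadratic field `ℚ(√d)`, `d > 0` (Friedberg–Hoffstein / Hoffstein–Luo twist with prescribed
residuosity at the bad primes; `d > 0` forced by the root numbers `w(W) = w(W^{(d)}) = +1`). -/
theorem stub_rankTwo :
    exists_isNewformOf → HoffsteinLuo1997_exists_twist_L_one_ne_zero →
    ∀ (W : WeierstrassCurve ℚ) [W.IsElliptic], W.analyticRank = 2 →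
      ∃ (m : ℕ) (_ : NeZero m),
        ∃ H : Subgroup (CyclotomicField m ℚ ≃ₐ[ℚ] CyclotomicField m ℚ),
          NumberField.IsTotallyReal ↥(IntermediateField.fixedField H) ∧
          Module.finrank ℚ ↥(IntermediateField.fixedField H) = W.analyticRank ∧
          ∀ χ : DirichletCharacter ℂ m,
            (∀ σ ∈ H, ∀ a : ℕ, (∀ z : CyclotomicField m ℚ, z ^ m = 1 → σ z = z ^ a) →
              χ (a : ZMod m) = 1) → χ ≠ 1 →
            ∃ L : ℂ → ℂ, Differentiable ℂ L ∧
              (∀ s : ℂ, 2 < s.re → L s = LSeries (fun n ↦ χ n * ((W.LFunction n : ℤ) : ℂ)) s) ∧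
              L 1 ≠ 0 :=
  Summit.BirchSwinnertonDyer.BirchSwinnertonDyer.Theorems.stub_rankTwo

/-- **Residual class** (OPEN; crux-sized): every elliptic `W` with `r_an(W) ≥ 3` that carries NO
Kurihara certificate at a prime `ℓ = r_an(W)` (first hypothesis) and for which NO prime `ℓ = r_an(W)`
lies in Kim's class (second hypothesis; implied by the first under the printed facts) — composite analytic rank (`4, 6, 8, 9, …`), or prime
analytic rank `ℓ` with `ℓ < 5` / bad or supersingular or anomalous reduction at `ℓ` / `ρ̄_{W,ℓ}` not
onto / `ℓ ∣ ∏ c_v` (e.g. `5077a1`, `r_an = 3`, `a₃ = −3`) — still has a silent totally real abelian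
field of degree `r_an(W)`: the crux conclusion itself on that class. No lever of this line reaches
it (joint silence for composite `r`; Kim needs the hypotheses at `ℓ`; at `ℓ = 3` Sakamoto 2022 +
Skinner–Urban would need their own facts — the next peel). -/
theorem stub_residual :
    ∀ (W : WeierstrassCurve ℚ) [W.IsElliptic], 3 ≤ W.analyticRank →
      (∀ (ℓ : ℕ) [Fact ℓ.Prime], W.analyticRank = ℓ →
        ∀ (N : ℕ) [NeZero N] (f : CuspForm (Gamma0 N) 2), IsNewformOf W f →
        ∀ (n : ℕ) [NeZero n], Squarefree n → n.Coprime N →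
        (∀ a : (ZMod n)ˣ, ¬ ℓ ∣ (ratPlusSymbol f (((a : ZMod n).val : ℚ) / n)).den) →
        ∀ ψ : (q : ℕ) → (ZMod q)ˣ →* Multiplicative (ZMod ℓ), kuriharaNumber f ℓ n ψ ≠ 0 →
        False) →
      (∀ (ℓ : ℕ) [Fact ℓ.Prime], W.analyticRank = ℓ → 5 ≤ ℓ → W.HasGoodReductionAtPrime ℓ →
        ¬ (ℓ : ℤ) ∣ W.LFunction ℓ → W.HasSurjectiveModNGaloisRep (ℓ : ℤ) →
        (∀ P : (W.baseChange ℚ_[ℓ]).toAffine.Point, (ℓ : ℤ) • P = 0 → P = 0) →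
        ¬ ℓ ∣ W.tamagawaProduct → False) →
      (W.analyticRank = 3 → W.HasGoodReductionAtPrime 3 → ¬ (3 : ℤ) ∣ W.LFunction 3 →
        (∀ m : ℕ, W.HasSurjectiveModNGaloisRep ((3 ^ m : ℕ) : ℤ)) →
        ¬ (3 : ℤ) ∣ 4 - W.LFunction 3 → ¬ 3 ∣ W.tamagawaProduct →
        (∃ (q : ℕ) (_ : Fact q.Prime), q ≠ 3 ∧ W.HasMultiplicativeReductionAtPrime q ∧
        ∃ (C : VariableChange ℚ) (_ : (C • W).IsGloballyMinimal),
          ¬ 3 ∣ padicValInt q (C • W).minimalDiscriminantInt) → False) →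
      ∃ (m : ℕ) (_ : NeZero m),
        ∃ H : Subgroup (CyclotomicField m ℚ ≃ₐ[ℚ] CyclotomicField m ℚ),
          NumberField.IsTotallyReal ↥(IntermediateField.fixedField H) ∧
          Module.finrank ℚ ↥(IntermediateField.fixedField H) = W.analyticRank ∧
          ∀ χ : DirichletCharacter ℂ m,
            (∀ σ ∈ H, ∀ a : ℕ, (∀ z : CyclotomicField m ℚ, z ^ m = 1 → σ z = z ^ a) →
              χ (a : ZMod m) = 1) → χ ≠ 1 →
            ∃ L : ℂ → ℂ, Differentiable ℂ L ∧
              (∀ s : ℂ, 2 < s.re → L s = LSeries (fun n ↦ χ n * ((W.LFunction n : ℤ) : ℂ)) s) ∧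
              L 1 ≠ 0 := by
  sorry

/-! ### Stub statements by name -/

namespace Statement

/-- Statement of `stub_printedFacts`. -/
abbrev stub_printedFacts : Prop := type_of% @KuriharaFourierSupport.stub_printedFacts
/-- Statement of `stub_primeRankKurihara`. -/
abbrev stub_primeRankKurihara : Prop := type_of% @KuriharaFourierSupport.stub_primeRankKurihara
/-- Statement of `stub_rankThreeSupply`. -/
abbrev stub_rankThreeSupply : Prop := type_of% @KuriharaFourierSupport.stub_rankThreeSupply
/-- Statement of `stub_rankTwo` (landed). -/
abbrev stub_rankTwo : Prop := type_of% @KuriharaFourierSupport.stub_rankTwo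
/-- Statement of `stub_residual`. -/
abbrev stub_residual : Prop := type_of% @KuriharaFourierSupport.stub_residual

end Statement

/-! ### Composition -/

/-- **Composition**: the three OPEN/BLOCKED stub statements (by name) — with the landed stubs
`stub_rankTwo` and `stub_kuriharaSupply` used as theorems — imply the crux `PlecticLegs.TwistSupply`
(by name). Cases: `r_an(W) = 2` (`stub_rankTwo`); a Kurihara certificate at a prime `ℓ = r_an(W)`
(`stub_primeRankKurihara`); a prime `ℓ = r_an(W)` in Kim's class (certificate from
`stub_kuriharaSupply` and the printed facts, then `stub_primeRankKurihara`); otherwise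
`stub_residual`. [folklore] -/
theorem TwistSupply_of (hFacts : Statement.stub_printedFacts) (hRes : Statement.stub_residual) :
    Summit.BirchSwinnertonDyer.BirchSwinnertonDyer.Theses.PlecticLegs.TwistSupply := by
  have hTwo : Statement.stub_rankTwo := stub_rankTwo
  have hThree : Statement.stub_rankThreeSupply := stub_rankThreeSupply
  have hPrime : Statement.stub_primeRankKurihara := stub_primeRankKurihara
  obtain ⟨hmod, hKim, hper, hHL, hSak, hper3, hSU⟩ := hFacts
  intro W instW hW
  by_cases h2 : W.analyticRank = 2
  · exact hTwo hmod hHL W h2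
  -- a Kurihara certificate at a prime `ℓ = r_an(W)`
  by_cases hcert : ∃ (ℓ : ℕ) (_ : Fact ℓ.Prime), W.analyticRank = ℓ ∧
      ∃ (N : ℕ) (_ : NeZero N) (f : CuspForm (Gamma0 N) 2), IsNewformOf W f ∧
        ∃ (n : ℕ) (_ : NeZero n), Squarefree n ∧ n.Coprime N ∧
          (∀ a : (ZMod n)ˣ, ¬ ℓ ∣ (ratPlusSymbol f (((a : ZMod n).val : ℚ) / n)).den) ∧
          ∃ ψ : (q : ℕ) → (ZMod q)ˣ →* Multiplicative (ZMod ℓ), kuriharaNumber f ℓ n ψ ≠ 0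
  · obtain ⟨ℓ, hℓ, hr, N, hN, f, hf, n, hn, hsq, hcop, hint, ψ, hδ⟩ := hcert
    exact hPrime W ℓ hr N f hf n hsq hcop hint ψ hδ
  -- Kim's class: the certificate comes from `stub_kuriharaSupply` and the printed facts
  by_cases hcase : ∃ (ℓ : ℕ) (_ : Fact ℓ.Prime), W.analyticRank = ℓ ∧ 5 ≤ ℓ ∧
      W.HasGoodReductionAtPrime ℓ ∧ ¬ (ℓ : ℤ) ∣ W.LFunction ℓ ∧
      W.HasSurjectiveModNGaloisRep (ℓ : ℤ) ∧
      (∀ P : (W.baseChange ℚ_[ℓ]).toAffine.Point, (ℓ : ℤ) • P = 0 → P = 0) ∧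
      ¬ ℓ ∣ W.tamagawaProduct
  · obtain ⟨ℓ, hℓ, hr, h5, hgood, hord, hsurj, htors, htam⟩ := hcase
    obtain ⟨N, hN, f, hf, n, hn, hsq, hcop, hint, ψ, hδ⟩ :=
      Summit.BirchSwinnertonDyer.BirchSwinnertonDyer.Theorems.stub_kuriharaSupply hmod hKim hper
        W ℓ h5 hgood hord hsurj htors htam
    exact hPrime W ℓ hr N f hf n hsq hcop hint ψ hδ
  -- analytic rank three in the Sakamoto–Skinner–Urban class
  by_cases h3 : W.analyticRank = 3 ∧ W.HasGoodReductionAtPrime 3 ∧ ¬ (3 : ℤ) ∣ W.LFunction 3 ∧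
      (∀ m : ℕ, W.HasSurjectiveModNGaloisRep ((3 ^ m : ℕ) : ℤ)) ∧
      ¬ (3 : ℤ) ∣ 4 - W.LFunction 3 ∧ ¬ 3 ∣ W.tamagawaProduct ∧
      (∃ (q : ℕ) (_ : Fact q.Prime), q ≠ 3 ∧ W.HasMultiplicativeReductionAtPrime q ∧
        ∃ (C : VariableChange ℚ) (_ : (C • W).IsGloballyMinimal),
          ¬ 3 ∣ padicValInt q (C • W).minimalDiscriminantInt)
  · obtain ⟨hr, hgood, hord, hsurj, hna, htam, haux⟩ := h3
    obtain ⟨N, hN, f, hf, n, hn, hsq, hcop, hint, ψ, hδ⟩ :=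
      hThree hmod hSak hper3 hSU W hgood hord hsurj hna htam haux
    exact hPrime W 3 hr N f hf n hsq hcop hint ψ hδ
  · refine hRes W (by omega) ?_ ?_ ?_
    · intro ℓ hℓ hr N hN f hf n hn hsq hcop hint ψ hδ
      exact hcert ⟨ℓ, hℓ, hr, N, hN, f, hf, n, hn, hsq, hcop, hint, ψ, hδ⟩
    · intro ℓ hℓ hr h5 hgood hord hsurj htors htam
      exact hcase ⟨ℓ, hℓ, hr, h5, hgood, hord, hsurj, htors, htam⟩
    · intro hr hgood hord hsurj hna htam haux
      exact h3 ⟨hr, hgood, hord, hsurj, hna, htam, haux⟩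

/-- The crux along this line, MODULO exactly the registered stubs (depends on `sorryAx` only
through `stub_*`). [folklore] -/
theorem TwistSupply_proof :
    Summit.BirchSwinnertonDyer.BirchSwinnertonDyer.Theses.PlecticLegs.TwistSupply :=
  TwistSupply_of stub_printedFacts stub_residual

end Summit.BirchSwinnertonDyer.BirchSwinnertonDyer.Cruxes.TwistSupply.KuriharaFourierSupport

end
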